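/-
Copyright (c) 2026 the pub-hodgecm-mathlib formalisation cell (harness21).  Prover seat hodgecm-mathlib-LH4-p02 (g12): STAGE 1a «(D-RAM) FOUR-FRAME» squad of
crux H413 (director s1808; heir LEAD F0P3a-plan (g18); dealer LH4-plan (g10) WORD #11 deal «`stub_U0_valency_typeTwo_wild` as tier 2»), 2026-09-03.
§1 is ADAPTED from ★ F0P3a-p07 (g11) `UnitaryLatticeTreeFixedCostarCoordsRamified` §3 and §2–§3 from ★ `UnitaryLatticeTreeTypeTwoStarCountRamified` §1–§2 (themselves
adapted from ★ B-p14 (g36) `UnitaryLatticeTreeTypeTwoStarCount`), with `σϖ = −ϖ` and residual triviality replaced by «non-zero `σ`-fixed elements have even valuation».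
-/
import Literature.NumberTheory.Automorphic.UnitaryLatticeTreeTypeTwoStarCountRamified    -- ★ tame twin (F0P3a-p07 (g11)); brings ★ `…StarOfInvolution`, `…TypeTwoStarCount`, `…FixedCostarCoordsRamified` (datum-free parts reused by name)
import Literature.NumberTheory.Automorphic.UnitaryLatticeTreeTypeTwoTransitiveWild        -- ★ p854569 htr₂-wild (this seat); brings ★ p854567 `v_le_sq_of_map_eq_self`, ★ `isVertexLattice_two_N₁_of_v`
import Literature.NumberTheory.Automorphic.UnitaryLatticeTreeSelfDualTransitiveWild       -- ★ p854568 (LH4-p01 (g17)): `v_map_sub_self_lt_one_of_even` (datum ⇒ residual triviality)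
import Literature.NumberTheory.Automorphic.UnitaryThreeFourFrameDefs                     -- ★ p854559 (#0a): `IsRamifiedQuadraticDatum`
import HarnessLib

/-!
# The lattice graph of a hermitian space — `q + 1` NEIGHBOURS AT EVERY TYPE-TWO VERTEX OF THE `U(3)` TREE AT ANY RAMIFIED PLACE, WILD DYADIC ONES INCLUDED
# (Tits 1979 §2.4 ∕ §2.7; Bruhat–Tits 1972 §10; Serre, *Trees* II.1.1; Jacobowitz 1962 §9)

Topic `NumberTheory/Automorphic`; namespace `Literature.NumberTheory.Automorphic.UnitaryLatticeTree`.  THEOREMS ONLY (no definition, no instance, no notation, no named fact,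
no `sorry`); kernel lane.  Cell `pub/hodgecm-mathlib` (D-0151), crux H413 = `stmt-HodgeConjecture-24833`; road «(D-RAM) FOUR-FRAME» (STAGE 1a), unit U0_WildTree, row
`stub_U0_valency_typeTwo_wild` (tier 2; desk INVENTORY v1.1): `#star(v) = q + 1` at every type-two vertex `v` of the lattice graph of `(K³, J₀)` for EVERY ramified datum
`IsRamifiedQuadraticDatum σ ϖ d t` (tame, ramified-prime, ramified-unit).  ★ `…TypeTwoStarCountRamified` proves this at TAME places from `σϖ = −ϖ`, `|2| = 1`, residual
triviality and the first-order norm property; the only uses are (i) «every primitive `(a,b)` gives a self-dual neighbour `N₁ + 𝒪w(a,b)`» through the ALTERNATING residual pairing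
and (ii) the transitivity binder `htr₂`.  HERE (§1) the neighbour's Gram corner `(σ(a)bϖ + σ(σ(a)bϖ))∕(ϖσϖ)` is integral at ANY ramified place because a `σ`-fixed element of
valuation `≤ |ϖ|` has valuation `≤ |ϖ|²` (★ `v_le_sq_of_map_eq_self`, i.e. `Tr(𝔭_E) ⊆ 𝔭_F` with no parity of `d`), and (ii) is ★ htr₂-wild `forall_isVertexLattice_two_exists_mapGL_N₁_eq_of_ramified`;
§2–§3 follow the ★ exhaustion and the `Option 𝓀 = ℙ¹(𝓀)` bijection verbatim (credited); §4 the counts and the DATUM-FORM HEAD in the shape of U0's stub.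
HONEST LABEL: HC_CM is proved only modulo the 7 printed citations (2 remaining: hLiu418 = stmt-HodgeConjecture-24832, h413 = stmt-HodgeConjecture-24833) until rung 0 closes; nothing
printed is asserted here; (D-RAM) `stub_DyRamCore` stays PRINT until the road's END lands.

* §1 `isVertexLattice_two_N₁_of_uniformizer`, **`isSelfDualLattice_N₁_sup_span_vec_of_even`**.  §2 `exists_eq_N₁_sup_span_vec_of_lt_of_even`, **`mem_neighborSet_N₁_iff_exists_vec_of_even`**.
* §3 **`natCard_neighborSet_N₁_eq_of_even`** (`= Nat.card (Option 𝓀[K])`).  §4 `ncard_neighborSet_N₁_of_even`, `ncard_neighborSet_of_isVertexLattice_two_of_even` (binder `htr₂`),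
  **`ncard_neighborSet_of_isVertexLattice_two_wild`** (`htr₂` discharged), **`ncard_neighborSet_of_isVertexLattice_two_of_isRamifiedQuadraticDatum`** (U0's stub shape).

## References
* [Tits1979] J. Tits, *Reductive groups over local fields*, PSPM 33.1 (1979), §2.4, §2.7 (ramified quasi-split `U(3)`: local index `(q+1, q+1)`).
* [BruhatTits1972] F. Bruhat, J. Tits, *Groupes réductifs sur un corps local I*, Publ. Math. IHÉS 41 (1972), §10.  [Serre1980Trees] J.-P. Serre, *Trees* (1980), Ch. II §1.1.
* [Jacobowitz1962] R. Jacobowitz, *Hermitian forms over local fields*, Amer. J. Math. 84 (1962), §§9–11.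
-/

set_option autoImplicit false

noncomputable section

open scoped Valued WithZero Matrix MatrixGroups

namespace Literature.NumberTheory.Automorphic.UnitaryLatticeTree

open Literature.NumberTheory.Automorphic Literature.NumberTheory.Automorphic.HermitianLattice Literature.NumberTheory.Automorphic.CartanUnique
open Literature.NumberTheory.Automorphic.UnitaryThreeFourFrame

variable {K : Type*} [Field K] [Valued K ℤᵐ⁰] {σ : K →+* K} {ϖ : K}

/-! ## §1 Every primitive neighbour of `N₁` is self-dual, at any ramified place -/

/-- `N₁ = latt diag(1,1,ϖ)` is a type-two vertex for any isometric `σ` and any uniformiser `ϖ` (★ `isVertexLattice_two_N₁_of_v`). [cite: BruhatTits1972, §10] -/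
theorem isVertexLattice_two_N₁_of_uniformizer (hvσ : ∀ a, Valued.v (σ a) = Valued.v a) (hϖ : Valued.v ϖ = WithZero.exp (-1 : ℤ)) :
    IsVertexLattice σ ϖ ((StdForm.antidiagonal 3).over K) 2 (latt (Matrix.diagonal ![(1 : K), 1, ϖ])) :=
  isVertexLattice_two_N₁_of_v hvσ (by rw [hϖ, ← WithZero.exp_zero]; exact WithZero.exp_le_exp.2 (by norm_num)) (uniformizer_ne_zero hϖ)

/-- **AT EVERY RAMIFIED PLACE EACH PRIMITIVE NEIGHBOUR OF `N₁` IS A SELF-DUAL VERTEX** — `σ` ANY isometric involution whose non-zero fixed elements have even valuation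
(tame, ramified-prime, ramified-unit alike; no `σϖ = −ϖ`, no `|2| = 1`, no residual hypothesis): for a primitive `(a, b) ∈ 𝒪²` the superlattice `N₁ + 𝒪w(a,b)`,
`w(a,b) = (a∕ϖ, 0, b)`, is self-dual for `J₀`.  `|a| = 1`: `L = latt g`, `g = [w | e₁ | ϖe₂]`, Gram `[[c, 0, σa·ϖ∕σϖ],[0,1,0],[a·σϖ∕ϖ, 0, 0]]` with the CORNER
`c = (σ(a)bϖ + σ(σ(a)bϖ)) ∕ (ϖσϖ)` INTEGRAL because its numerator is `σ`-fixed of valuation `≤ |ϖ|`, hence `≤ |ϖ|²` (★ `v_le_sq_of_map_eq_self`: the trace `Tr(𝔭_E) ⊆ 𝔭_F`), and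
`det = −σ(a)a` a unit; `|a| < 1`: `L = 𝒪³` (★ `isSelfDualLattice_stdLattice`).  The twin of ★ `isSelfDualLattice_N₁_sup_span_vec_of_neg` (σϖ = −ϖ, residual triviality), whose
proof is followed verbatim outside the corner. [cite: Jacobowitz1962, §9] [cite: BruhatTits1972, §10] [cite: Serre1980Trees, II.1.1] -/
theorem isSelfDualLattice_N₁_sup_span_vec_of_even (hσ : ∀ x, σ (σ x) = x) (hvσ : ∀ a, Valued.v (σ a) = Valued.v a)
    (hϖ : Valued.v ϖ = WithZero.exp (-1 : ℤ)) (heven : ∀ x : K, σ x = x → x ≠ 0 → ∃ n : ℤ, Valued.v x = WithZero.exp (2 * n))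
    {a b : K} (ha : Valued.v a ≤ 1) (hb : Valued.v b ≤ 1) (hprim : Valued.v a = 1 ∨ Valued.v b = 1) :
    IsSelfDualLattice σ ϖ ((StdForm.antidiagonal 3).over K) (latt (Matrix.diagonal ![(1 : K), 1, ϖ]) ⊔ Submodule.span 𝒪[K] {(![a / ϖ, 0, b] : Fin 3 → K)}) := by
  have hϖ0 : ϖ ≠ 0 := fun h0 => by rw [h0, map_zero] at hϖ; exact WithZero.coe_ne_zero hϖ.symm
  have hvϖ0 : Valued.v ϖ ≠ 0 := (Valuation.ne_zero_iff _).2 hϖ0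
  have hϖ1 : Valued.v ϖ ≤ 1 := by rw [hϖ, ← WithZero.exp_zero]; exact WithZero.exp_le_exp.2 (by norm_num)
  have hlt : ∀ z : K, Valued.v z < 1 ↔ Valued.v z ≤ Valued.v ϖ := fun z => by rw [hϖ]; exact v_lt_one_iff z
  have hd' : ∀ i, (![(1 : K), 1, ϖ] : Fin 3 → K) i ≠ 0 := by intro i; fin_cases i <;> simp [hϖ0]
  have hσϖ0 : σ ϖ ≠ 0 := (map_ne_zero σ).2 hϖ0
  -- the corner entry: `σ(a)bϖ + σ(σ(a)bϖ)` is `σ`-fixed of valuation `≤ |ϖ|`, hence `≤ |ϖ|² = |ϖσϖ|` (ramified: even valuation)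
  have hcorner : Valued.v ((σ a * b * ϖ + σ b * a * σ ϖ) / (ϖ * σ ϖ)) ≤ 1 := by
    have hfix : σ (σ a * b * ϖ + σ b * a * σ ϖ) = σ a * b * ϖ + σ b * a * σ ϖ := by simp only [map_add, map_mul, hσ]; ring
    have hle : Valued.v (σ a * b * ϖ + σ b * a * σ ϖ) ≤ Valued.v ϖ := by
      refine (Valuation.map_add _ _ _).trans (max_le ?_ ?_)
      · rw [map_mul, map_mul, hvσ]; exact mul_le_of_le_one_left' (mul_le_one' ha hb)
      · rw [map_mul, map_mul, hvσ, hvσ]; exact mul_le_of_le_one_left' (mul_le_one' hb ha)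
    have h2 := v_le_sq_of_map_eq_self hϖ heven hfix hle
    rw [map_div₀, map_mul, hvσ, ← pow_two]
    exact div_le_one_of_le₀ h2 zero_le
  have h02 : Valued.v (σ a * ϖ / σ ϖ) ≤ 1 := by
    rw [map_div₀, map_mul, hvσ, hvσ, mul_div_assoc, div_self hvϖ0, mul_one]; exact ha
  have h20' : Valued.v (a * σ ϖ / ϖ) ≤ 1 := by
    rw [map_div₀, map_mul, hvσ, mul_div_assoc, div_self hvϖ0, mul_one]; exact ha
  -- `J₀` in coordinates
  have hJ : ∀ i j : Fin 3, (StdForm.antidiagonal 3).over K i j = if j = Fin.rev i then (1 : K) else 0 := by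
    intro i j
    simp only [StdForm.over, Matrix.map_apply, StdForm.antidiagonal_J_apply]
    split_ifs <;> simp
  by_cases ha1 : Valued.v a = 1
  · -- `|a| = 1`: `L = latt g`, `g = [w | e₁ | ϖe₂]`
    have ha0 : a ≠ 0 := fun h0 => by rw [h0, map_zero] at ha1; exact zero_ne_one ha1
    set g : Matrix (Fin 3) (Fin 3) K := !![a / ϖ, 0, 0; 0, 1, 0; b, 0, ϖ] with hg
    have hgdet : g.det = a := by rw [hg, Matrix.det_fin_three]; simp; field_simp
    have hgdet0 : g.det ≠ 0 := by rw [hgdet]; exact ha0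
    have hcol0 : g.mulVec (Pi.single 0 1) = ![a / ϖ, 0, b] := by
      rw [Matrix.mulVec_single_one]; funext i; fin_cases i <;> simp [hg]
    have hcol1 : g.mulVec (Pi.single 1 1) = Pi.single 1 1 := by
      rw [Matrix.mulVec_single_one]; funext i; fin_cases i <;> simp [hg]
    have hcol2 : g.mulVec (Pi.single 2 1) = ϖ • Pi.single 2 1 := by
      rw [Matrix.mulVec_single_one]; funext i; fin_cases i <;> simp [hg]
    have hL : latt (Matrix.diagonal ![(1 : K), 1, ϖ]) ⊔ Submodule.span 𝒪[K] {(![a / ϖ, 0, b] : Fin 3 → K)} = latt g := by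
      apply le_antisymm
      · refine sup_le ((latt_le_iff_forall_mulVec_single_mem _ _).2 fun j => ?_) ((Submodule.span_singleton_le_iff_mem _ _).2 ?_)
        · fin_cases j
          · -- `e₀ = (ϖ∕a)·w − (b∕a)·(ϖe₂)`
            have hmem : ((⟨ϖ / a, (Valuation.mem_integer_iff _ _).2 (by rw [map_div₀, ha1, div_one]; exact hϖ1)⟩ : 𝒪[K]) • g.mulVec (Pi.single 0 1) -
                (⟨b / a, (Valuation.mem_integer_iff _ _).2 (by rw [map_div₀, ha1, div_one]; exact hb)⟩ : 𝒪[K]) • g.mulVec (Pi.single 2 1)) ∈ latt g :=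
              Submodule.sub_mem _ (Submodule.smul_mem _ _ (mulVec_single_mem_latt g 0)) (Submodule.smul_mem _ _ (mulVec_single_mem_latt g 2))
            have heq : ((⟨ϖ / a, (Valuation.mem_integer_iff _ _).2 (by rw [map_div₀, ha1, div_one]; exact hϖ1)⟩ : 𝒪[K]) • g.mulVec (Pi.single 0 1) -
                (⟨b / a, (Valuation.mem_integer_iff _ _).2 (by rw [map_div₀, ha1, div_one]; exact hb)⟩ : 𝒪[K]) • g.mulVec (Pi.single 2 1) : Fin 3 → K) =
                (Matrix.diagonal ![(1 : K), 1, ϖ]).mulVec (Pi.single 0 1) := by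
              change (ϖ / a) • g.mulVec (Pi.single 0 1) - (b / a) • g.mulVec (Pi.single 2 1) = _
              rw [hcol0, hcol2, Matrix.mulVec_single_one]
              funext i; fin_cases i <;> simp <;> field_simp
              ring
            rw [Fin.zero_eta, ← heq]; exact hmem
          · have : (Matrix.diagonal ![(1 : K), 1, ϖ]).mulVec (Pi.single 1 1) = g.mulVec (Pi.single 1 1) := by
              rw [hcol1, Matrix.mulVec_single_one]; funext i; fin_cases i <;> simp
            rw [Fin.mk_one, this]; exact mulVec_single_mem_latt g 1
          · have : (Matrix.diagonal ![(1 : K), 1, ϖ]).mulVec (Pi.single 2 1) = g.mulVec (Pi.single 2 1) := by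
              rw [hcol2, Matrix.mulVec_single_one]; funext i; fin_cases i <;> simp
            simp only [Fin.reduceFinMk]; rw [this]; exact mulVec_single_mem_latt g 2
        · rw [← hcol0]; exact mulVec_single_mem_latt g 0
      · refine (latt_le_iff_forall_mulVec_single_mem _ _).2 fun j => ?_
        fin_cases j
        · rw [Fin.zero_eta, hcol0]; exact Submodule.mem_sup_right (Submodule.mem_span_singleton_self _)
        · rw [Fin.mk_one, hcol1]
          exact Submodule.mem_sup_left ((mem_latt_diagonal_iff hd' _).2 fun i => by fin_cases i <;> simp)
        · simp only [Fin.reduceFinMk]; rw [hcol2]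
          exact Submodule.mem_sup_left ((mem_latt_diagonal_iff hd' _).2 fun i => by fin_cases i <;> simp)
    rw [hL]
    -- the Gram matrix of `g` for a GENERAL involution (`σ(a∕ϖ) = σa∕σϖ`)
    set c : K := (σ a * b * ϖ + σ b * a * σ ϖ) / (ϖ * σ ϖ) with hc
    set p : K := σ a * ϖ / σ ϖ with hp
    set q : K := a * σ ϖ / ϖ with hq
    have hG : formCongr σ (Matrix.GeneralLinearGroup.mkOfDetNeZero _ hgdet0) ((StdForm.antidiagonal 3).over K) = !![c, 0, p; 0, 1, 0; q, 0, 0] := by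
      rw [formCongr, Matrix.GeneralLinearGroup.val_mkOfDetNeZero, hc, hp, hq]
      ext i j
      fin_cases i <;> fin_cases j <;> simp [Matrix.mul_apply, Fin.sum_univ_three, hg, hJ, Fin.rev, Matrix.map_apply, map_div₀] <;> field_simp
      ring
    have hGdet : (!![c, 0, p; 0, 1, 0; q, 0, 0] : Matrix (Fin 3) (Fin 3) K).det = -(σ a * a) := by
      have hpq : p * q = σ a * a := by rw [hp, hq]; field_simp
      have hdet3 : ∀ x y z : K, (!![x, 0, y; 0, 1, 0; z, 0, 0] : Matrix (Fin 3) (Fin 3) K).det = -(y * z) := fun x y z => by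
        simp [Matrix.det_fin_three]
      rw [hdet3, hpq]
    have hGint : IsIntMatrix (!![c, 0, p; 0, 1, 0; q, 0, 0] : Matrix (Fin 3) (Fin 3) K) := by
      intro i j
      fin_cases i <;> fin_cases j <;> simp [hcorner, h02, h20']
    have hvdet : Valued.v (!![c, 0, p; 0, 1, 0; q, 0, 0] : Matrix (Fin 3) (Fin 3) K).det = 1 := by
      rw [hGdet, Valuation.map_neg, map_mul, hvσ, ha1, one_mul]
    refine ⟨Matrix.GeneralLinearGroup.mkOfDetNeZero _ hgdet0, by rw [Matrix.GeneralLinearGroup.val_mkOfDetNeZero], ?_, ?_, ?_⟩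
    · rw [hG]; exact hGint
    · rw [hG]; intro i j; rw [Matrix.smul_apply, smul_eq_mul, map_mul]; exact mul_le_one' hϖ1 (isIntMatrix_nonsing_inv_of_v_det_eq_one hGint hvdet i j)
    · rw [hG, hvdet, pow_zero]
  · -- `|a| < 1`, hence `|b| = 1` (primitive): `L = 𝒪³ = L₀`
    have hb1 : Valued.v b = 1 := hprim.resolve_left ha1
    have halt' : Valued.v a < 1 := lt_of_le_of_ne ha ha1
    have hb0 : b ≠ 0 := fun h0 => by rw [h0, map_zero] at hb1; exact zero_ne_one hb1
    have hL : latt (Matrix.diagonal ![(1 : K), 1, ϖ]) ⊔ Submodule.span 𝒪[K] {(![a / ϖ, 0, b] : Fin 3 → K)} = stdLattice K 3 := by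
      apply le_antisymm
      · refine sup_le (scaleLattice_stdLattice_le_N₁_le hϖ1 hϖ0).2 ((Submodule.span_singleton_le_iff_mem _ _).2 fun i => ?_)
        fin_cases i
        · simp only [Fin.zero_eta, Matrix.cons_val_zero, map_div₀, div_le_one₀ (zero_lt_iff.2 hvϖ0)]; exact (hlt _).1 halt'
        · simp
        · simpa using hb
      · -- `𝒪³ = latt 1`; `e₀, e₁ ∈ N₁`, `e₂ = b⁻¹·(w − (a∕ϖ)·e₀)`
        rw [← latt_one]
        refine (latt_le_iff_forall_mulVec_single_mem _ _).2 fun j => ?_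
        rw [Matrix.one_mulVec]
        fin_cases j
        · exact Submodule.mem_sup_left ((mem_latt_diagonal_iff hd' _).2 fun i => by fin_cases i <;> simp)
        · exact Submodule.mem_sup_left ((mem_latt_diagonal_iff hd' _).2 fun i => by fin_cases i <;> simp)
        · have haϖ : Valued.v (a / ϖ) ≤ 1 := by rw [map_div₀, div_le_one₀ (zero_lt_iff.2 hvϖ0)]; exact (hlt _).1 halt'
          have hbinv : Valued.v b⁻¹ ≤ 1 := by rw [map_inv₀, hb1, inv_one]
          have hmem : ((⟨b⁻¹, (Valuation.mem_integer_iff _ _).2 hbinv⟩ : 𝒪[K]) •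
              ((![a / ϖ, 0, b] : Fin 3 → K) - (⟨a / ϖ, (Valuation.mem_integer_iff _ _).2 haϖ⟩ : 𝒪[K]) • (![1, 0, 0] : Fin 3 → K))) ∈
              latt (Matrix.diagonal ![(1 : K), 1, ϖ]) ⊔ Submodule.span 𝒪[K] {(![a / ϖ, 0, b] : Fin 3 → K)} :=
            Submodule.smul_mem _ _ (Submodule.sub_mem _ (Submodule.mem_sup_right (Submodule.mem_span_singleton_self _))
              (Submodule.smul_mem _ _ (Submodule.mem_sup_left ((mem_latt_diagonal_iff hd' _).2 fun i => by fin_cases i <;> simp))))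
          have heq : ((⟨b⁻¹, (Valuation.mem_integer_iff _ _).2 hbinv⟩ : 𝒪[K]) •
              ((![a / ϖ, 0, b] : Fin 3 → K) - (⟨a / ϖ, (Valuation.mem_integer_iff _ _).2 haϖ⟩ : 𝒪[K]) • (![1, 0, 0] : Fin 3 → K)) : Fin 3 → K) =
              ![0, 0, 1] := by
            change b⁻¹ • ((![a / ϖ, 0, b] : Fin 3 → K) - (a / ϖ) • (![1, 0, 0] : Fin 3 → K)) = ![0, 0, 1]
            funext i; fin_cases i <;> simp [hb0]
          have hsingle : (Pi.single 2 1 : Fin 3 → K) = ![0, 0, 1] := by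
            funext i; fin_cases i <;> simp
          simp only [Fin.reduceFinMk]; rw [hsingle, ← heq]; exact hmem
    rw [hL]
    refine isSelfDualLattice_stdLattice (fun i j => ?_) (fun i j => ?_) ?_ hϖ1
    · rw [hJ]; split_ifs <;> simp
    · rw [StdForm.inv_over, hJ]; split_ifs <;> simp
    · have hdet : ((StdForm.antidiagonal 3).over K).det = -1 := by
        rw [Matrix.det_fin_three]; simp [hJ, Fin.rev]
      rw [hdet, Valuation.map_neg, map_one]

/-! ## §2 Exhaustion of the star of `N₁` at a ramified place -/

/-- **EXHAUSTION OF THE STAR OF `N₁` (any ramified place)**: a self-dual vertex `L > N₁` is `N₁ + 𝒪w(a,b)` for a PRIMITIVE integral pair `(a,b)` — `L ≤ L^♯ ≤ N₁^♯ = latt diag(ϖ⁻¹,1,1)`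
(★ `dualLatt_N₁_of_v`), a vector of `L ∖ N₁` reduces to a primitive `w(a,b) ∈ L` (★ `sub_vec_mem_N₁_of_mem_dual`), and `N₁ + 𝒪w(a,b) ≤ L` are two self-dual vertices
(★ `isSelfDualLattice_N₁_sup_span_vec_of_neg` — no isotropy condition at a ramified place), equal by (D2). [cite: BruhatTits1972, §10] [cite: Jacobowitz1962, §7–§8] [cite: Serre1980Trees, II.1.1] -/
theorem exists_eq_N₁_sup_span_vec_of_lt_of_even (hσ : ∀ x, σ (σ x) = x) (hvσ : ∀ a, Valued.v (σ a) = Valued.v a) (hϖ : Valued.v ϖ = WithZero.exp (-1 : ℤ))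
    (heven : ∀ x : K, σ x = x → x ≠ 0 → ∃ n : ℤ, Valued.v x = WithZero.exp (2 * n)) {L : Submodule 𝒪[K] (Fin 3 → K)}
    (hL : IsSelfDualLattice σ ϖ ((StdForm.antidiagonal 3).over K) L) (hlt : latt (Matrix.diagonal ![(1 : K), 1, ϖ]) < L) :
    ∃ a b : K, Valued.v a ≤ 1 ∧ Valued.v b ≤ 1 ∧ (Valued.v a = 1 ∨ Valued.v b = 1) ∧
      L = latt (Matrix.diagonal ![(1 : K), 1, ϖ]) ⊔ Submodule.span 𝒪[K] {(![a / ϖ, 0, b] : Fin 3 → K)} := by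
  have hϖ0 : ϖ ≠ 0 := uniformizer_ne_zero hϖ
  -- `L ≤ L^♯ ≤ N₁^♯ = latt diag(ϖ⁻¹, 1, 1)`
  have hLd : L ≤ latt (Matrix.diagonal ![ϖ⁻¹, (1 : K), 1]) :=
    calc L ≤ dualLatt σ ((StdForm.antidiagonal 3).over K) L := le_dualLatt_of_isVertexLattice hvσ hL
      _ ≤ dualLatt σ ((StdForm.antidiagonal 3).over K) (latt (Matrix.diagonal ![(1 : K), 1, ϖ])) := dualLatt_antitone σ _ hlt.le
      _ = latt (Matrix.diagonal ![ϖ⁻¹, (1 : K), 1]) := dualLatt_N₁_of_v hvσ hϖ0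
  obtain ⟨w, hwL, hwN⟩ := SetLike.exists_of_lt hlt
  obtain ⟨ha, hb, hsub⟩ := sub_vec_mem_N₁_of_mem_dual hϖ (hLd hwL)
  -- `w(a,b) ∈ L`, primitive
  have hw'L : (![ϖ * w 0 / ϖ, 0, w 2] : Fin 3 → K) ∈ L := by
    have h : w - (w - ![ϖ * w 0 / ϖ, 0, w 2]) ∈ L := Submodule.sub_mem _ hwL (hlt.le hsub)
    rwa [sub_sub_cancel] at h
  have hprim : Valued.v (ϖ * w 0) = 1 ∨ Valued.v (w 2) = 1 := by
    by_contra h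
    push Not at h
    have hmem : (![ϖ * w 0 / ϖ, 0, w 2] : Fin 3 → K) ∈ latt (Matrix.diagonal ![(1 : K), 1, ϖ]) :=
      (vec_mem_N₁_iff hϖ _ _).2 ⟨lt_of_le_of_ne ha h.1, lt_of_le_of_ne hb h.2⟩
    have hw : w ∈ latt (Matrix.diagonal ![(1 : K), 1, ϖ]) := by
      have := Submodule.add_mem _ hsub hmem
      rwa [sub_add_cancel] at this
    exact hwN hw
  -- `N₁ + 𝒪w(a,b) ≤ L`, both self-dual
  have hL' := isSelfDualLattice_N₁_sup_span_vec_of_even hσ hvσ hϖ heven ha hb hprim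
  have hle : latt (Matrix.diagonal ![(1 : K), 1, ϖ]) ⊔ Submodule.span 𝒪[K] {(![ϖ * w 0 / ϖ, 0, w 2] : Fin 3 → K)} ≤ L :=
    sup_le hlt.le (Submodule.span_le.2 (Set.singleton_subset_iff.2 hw'L))
  exact ⟨ϖ * w 0, w 2, ha, hb, hprim, (eq_of_le_of_isVertexLattice hvσ hϖ0 hL' hL hle).symm⟩

/-- **`star(N₁) = {N₁ + 𝒪w(a,b) | (a,b) ∈ 𝒪² primitive}` at a ramified place** — the whole projective line. [cite: BruhatTits1972, §10] [cite: Tits1979, §3.5] [cite: Serre1980Trees, II.1.1] -/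
theorem mem_neighborSet_N₁_iff_exists_vec_of_even (hσ : ∀ x, σ (σ x) = x) (hvσ : ∀ a, Valued.v (σ a) = Valued.v a) (hϖ : Valued.v ϖ = WithZero.exp (-1 : ℤ))
    (heven : ∀ x : K, σ x = x → x ≠ 0 → ∃ n : ℤ, Valued.v x = WithZero.exp (2 * n))
    (w : {M : Submodule 𝒪[K] (Fin 3 → K) // IsVertex σ ϖ ((StdForm.antidiagonal 3).over K) M}) :
    w ∈ (latticeGraph σ ϖ ((StdForm.antidiagonal 3).over K)).neighborSet ⟨latt (Matrix.diagonal ![(1 : K), 1, ϖ]), 2, isVertexLattice_two_N₁_of_uniformizer hvσ hϖ⟩ ↔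
      ∃ a b : K, Valued.v a ≤ 1 ∧ Valued.v b ≤ 1 ∧ (Valued.v a = 1 ∨ Valued.v b = 1) ∧
        w.1 = latt (Matrix.diagonal ![(1 : K), 1, ϖ]) ⊔ Submodule.span 𝒪[K] {(![a / ϖ, 0, b] : Fin 3 → K)} := by
  rw [mem_neighborSet_N₁_iff_of_v hvσ hϖ (isVertexLattice_two_N₁_of_uniformizer hvσ hϖ)]
  constructor
  · intro hlt
    have h0 : IsSelfDualLattice σ ϖ ((StdForm.antidiagonal 3).over K) w.1 :=
      (isVertexLattice_two_and_isSelfDualLattice_of_lt_of_v hvσ hϖ ⟨2, isVertexLattice_two_N₁_of_uniformizer hvσ hϖ⟩ w.2 hlt).2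
    exact exists_eq_N₁_sup_span_vec_of_lt_of_even hσ hvσ hϖ heven h0 hlt
  · rintro ⟨a, b, -, -, hprim, hw⟩
    rw [hw]
    exact N₁_lt_N₁_sup_span_vec hϖ hprim

/-! ## §3 The bijection with `ℙ¹(𝓀) = Option 𝓀`: `[0:1]`, `[1:t]` -/

/-- **THE STAR OF `N₁` ↔ THE PROJECTIVE LINE OVER THE RESIDUE FIELD (any ramified place)**: `#star(N₁) = #(Option 𝓀[K])` — the point `[0:1]` (the neighbour `N₁ + 𝒪e₂ = L₀`) and the
points `[1:t]`, `t ∈ 𝓀` (the neighbours `N₁ + 𝒪w(1,B)`, `B` any lift of `t`).  Valid for ANY residue field. [cite: BruhatTits1972, §10] [cite: Tits1979, §2.4] [cite: Serre1980Trees, II.1.1] -/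
theorem natCard_neighborSet_N₁_eq_of_even (hσ : ∀ x, σ (σ x) = x) (hvσ : ∀ a, Valued.v (σ a) = Valued.v a) (hϖ : Valued.v ϖ = WithZero.exp (-1 : ℤ))
    (heven : ∀ x : K, σ x = x → x ≠ 0 → ∃ n : ℤ, Valued.v x = WithZero.exp (2 * n)) :
    Nat.card ((latticeGraph σ ϖ ((StdForm.antidiagonal 3).over K)).neighborSet ⟨latt (Matrix.diagonal ![(1 : K), 1, ϖ]), 2, isVertexLattice_two_N₁_of_uniformizer hvσ hϖ⟩) = Nat.card (Option 𝓀[K]) := by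
  classical
  have h0 : Valued.v (0 : K) < 1 := by rw [map_zero]; exact zero_lt_one
  obtain ⟨lift, hlift⟩ : ∃ lift : 𝓀[K] → 𝒪[K], ∀ a, IsLocalRing.residue 𝒪[K] (lift a) = a :=
    ⟨Function.surjInv IsLocalRing.residue_surjective, Function.surjInv_eq IsLocalRing.residue_surjective⟩
  -- the normalised pairs `(a_p, b_p)`: `(0, 1)` and `(1, lift t)`
  let aOf : Option 𝓀[K] → K := fun p => p.elim 0 fun _ => 1
  let bOf : Option 𝓀[K] → K := fun p => p.elim 1 fun t => (lift t : K)
  have ha_none : aOf none = 0 := rfl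
  have hb_none : bOf none = 1 := rfl
  have ha_some : ∀ t, aOf (some t) = 1 := fun _ => rfl
  have hb_some : ∀ t, bOf (some t) = (lift t : K) := fun _ => rfl
  have ha : ∀ p, Valued.v (aOf p) ≤ 1 := by
    rintro (_ | t)
    · rw [ha_none, map_zero]; exact zero_le_one
    · rw [ha_some, map_one]
  have hb : ∀ p, Valued.v (bOf p) ≤ 1 := by
    rintro (_ | t)
    · rw [hb_none, map_one]
    · rw [hb_some]; exact (lift t).2
  have hprim : ∀ p, Valued.v (aOf p) = 1 ∨ Valued.v (bOf p) = 1 := by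
    rintro (_ | t)
    · exact Or.inr (by rw [hb_none, map_one])
    · exact Or.inl (by rw [ha_some, map_one])
  -- the vertices `N₁ + 𝒪w(a_p, b_p)` of the star: ALL self-dual at a ramified place
  have hsd : ∀ p, IsSelfDualLattice σ ϖ ((StdForm.antidiagonal 3).over K)
      (latt (Matrix.diagonal ![(1 : K), 1, ϖ]) ⊔ Submodule.span 𝒪[K] {(![aOf p / ϖ, 0, bOf p] : Fin 3 → K)}) := fun p =>
    isSelfDualLattice_N₁_sup_span_vec_of_even hσ hvσ hϖ heven (ha p) (hb p) (hprim p)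
  let f : Option 𝓀[K] → (latticeGraph σ ϖ ((StdForm.antidiagonal 3).over K)).neighborSet ⟨latt (Matrix.diagonal ![(1 : K), 1, ϖ]), 2, isVertexLattice_two_N₁_of_uniformizer hvσ hϖ⟩ := fun p =>
    ⟨⟨latt (Matrix.diagonal ![(1 : K), 1, ϖ]) ⊔ Submodule.span 𝒪[K] {(![aOf p / ϖ, 0, bOf p] : Fin 3 → K)}, 0, hsd p⟩,
      (mem_neighborSet_N₁_iff_of_v hvσ hϖ (isVertexLattice_two_N₁_of_uniformizer hvσ hϖ) _).2 (N₁_lt_N₁_sup_span_vec hϖ (hprim p))⟩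
  have hf : ∀ p, (f p).1.1 = latt (Matrix.diagonal ![(1 : K), 1, ϖ]) ⊔ Submodule.span 𝒪[K] {(![aOf p / ϖ, 0, bOf p] : Fin 3 → K)} := fun _ => rfl
  -- `w(a_p, b_p)` is level one over `N₁`
  have hlev : ∀ p, ϖ • (![aOf p / ϖ, 0, bOf p] : Fin 3 → K) ∈ latt (Matrix.diagonal ![(1 : K), 1, ϖ]) := fun p => smul_ϖ_vec_mem_N₁ hϖ (ha p) (hb p)
  have hnot : ∀ p, (![aOf p / ϖ, 0, bOf p] : Fin 3 → K) ∉ latt (Matrix.diagonal ![(1 : K), 1, ϖ]) := fun p hmem => by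
    obtain ⟨h1, h2⟩ := (vec_mem_N₁_iff hϖ _ _).1 hmem
    rcases hprim p with h | h
    · exact absurd h h1.ne
    · exact absurd h h2.ne
  refine (Nat.card_congr (Equiv.ofBijective f ⟨?_, ?_⟩)).symm
  · -- injective: equal lattices ⇒ proportional residual pairs ⇒ equal normalised parameters
    intro p p' hpp'
    have hEq : (f p').1.1 = (f p).1.1 := by rw [hpp']
    rw [hf, hf] at hEq
    obtain ⟨c, hc, hmem⟩ := (sup_span_eq_sup_span_iff hϖ (hlev p) (hnot p')).1 hEq
    rw [vec_sub_smul_vec, vec_mem_N₁_iff hϖ] at hmem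
    obtain ⟨h1, h2⟩ := hmem
    rcases p with _ | t <;> rcases p' with _ | t'
    · rfl
    · rw [ha_none, ha_some, mul_zero, sub_zero, map_one] at h1
      exact absurd h1 (lt_irrefl 1)
    · rw [ha_some, ha_none, mul_one, zero_sub, Valuation.map_neg, hc] at h1
      exact absurd h1 (lt_irrefl 1)
    · rw [ha_some, ha_some, mul_one] at h1
      rw [hb_some, hb_some] at h2
      -- `|B′ − B| ≤ max(|B′ − cB|, |(c − 1)B|) < 1`
      have h3 : Valued.v ((lift t' : K) - (lift t : K)) < 1 := by
        have e : (lift t' : K) - (lift t : K) = ((lift t' : K) - c * (lift t : K)) + (c - 1) * (lift t : K) := by ring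
        rw [e]
        refine (Valuation.map_add _ _ _).trans_lt (max_lt h2 ?_)
        rw [map_mul, ← Valuation.map_neg, neg_sub]
        calc Valued.v (1 - c) * Valued.v (lift t : K) ≤ Valued.v (1 - c) * 1 := mul_le_mul_right (lift t).2 _
          _ < 1 := by rw [mul_one]; exact h1
      have h4 := residue_eq_of_v_sub_lt_one h3
      rw [hlift, hlift] at h4
      subst h4
      rfl
  · -- surjective: every vertex of the star is `N₁ + 𝒪w(a_p, b_p)` for a normalised `p`
    rintro ⟨w, hw⟩
    obtain ⟨a, b, ha', hb', hprim', hw1⟩ := (mem_neighborSet_N₁_iff_exists_vec_of_even hσ hvσ hϖ heven w).1 hw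
    -- it suffices to exhibit `p` and a unit `c` with `w(a,b) − c·w(a_p,b_p) ∈ N₁`
    have key : ∀ p (c : K), Valued.v c = 1 → Valued.v (a - c * aOf p) < 1 → Valued.v (b - c * bOf p) < 1 → f p = ⟨w, hw⟩ := by
      intro p c hc h1 h2
      apply Subtype.ext; apply Subtype.ext
      rw [hf, hw1]
      refine (sup_span_eq_sup_span_of_sub_mem hc ?_).symm
      rw [vec_sub_smul_vec, vec_mem_N₁_iff hϖ]
      exact ⟨h1, h2⟩
    by_cases ha1 : Valued.v a = 1
    · -- `|a| = 1`: `p = [1 : b∕a]`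
      have hBint : Valued.v (b / a) ≤ 1 := by rw [map_div₀, ha1, div_one]; exact hb'
      set B : 𝒪[K] := ⟨b / a, hBint⟩ with hBdef
      refine ⟨some (IsLocalRing.residue 𝒪[K] B), key _ a ha1 ?_ ?_⟩
      · rw [ha_some, mul_one, sub_self]; exact h0
      · rw [hb_some]
        have e : b - a * (lift (IsLocalRing.residue 𝒪[K] B) : K) = a * ((B : K) - (lift (IsLocalRing.residue 𝒪[K] B) : K)) := by
          have ha0 : a ≠ 0 := fun h => by rw [h, map_zero] at ha1; exact zero_ne_one ha1
          change b - a * _ = a * (b / a - _)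
          field_simp
        rw [e, map_mul, ha1, one_mul, show (B : K) - (lift (IsLocalRing.residue 𝒪[K] B) : K) = ((B - lift (IsLocalRing.residue 𝒪[K] B) : 𝒪[K]) : K) from rfl,
          ← residue_eq_zero_iff_v_lt_one, map_sub, hlift, sub_self]
    · -- `|a| < 1`: then `|b| = 1` and `p = [0 : 1]`
      have hb1 : Valued.v b = 1 := hprim'.resolve_left ha1
      refine ⟨none, key none b hb1 ?_ ?_⟩
      · rw [ha_none, mul_zero, sub_zero]; exact lt_of_le_of_ne ha' ha1
      · rw [hb_none, mul_one, sub_self]; exact h0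

/-! ## §4 The counts: `q + 1` neighbours at every type-two vertex, every ramified datum -/

/-- **`#star(N₁) = q + 1` AT ANY RAMIFIED PLACE** (`q = |𝓀[K]|`; finite residue field). [cite: Tits1979, §2.4] [cite: BruhatTits1972, §10] [cite: Serre1980Trees, II.1.1] -/
theorem ncard_neighborSet_N₁_of_even (hσ : ∀ x, σ (σ x) = x) (hvσ : ∀ a, Valued.v (σ a) = Valued.v a) (hϖ : Valued.v ϖ = WithZero.exp (-1 : ℤ))
    (heven : ∀ x : K, σ x = x → x ≠ 0 → ∃ n : ℤ, Valued.v x = WithZero.exp (2 * n)) [Finite 𝓀[K]] :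
    ((latticeGraph σ ϖ ((StdForm.antidiagonal 3).over K)).neighborSet ⟨latt (Matrix.diagonal ![(1 : K), 1, ϖ]), 2, isVertexLattice_two_N₁_of_uniformizer hvσ hϖ⟩).ncard = Nat.card 𝓀[K] + 1 := by
  rw [← Nat.card_coe_set_eq, natCard_neighborSet_N₁_eq_of_even hσ hvσ hϖ heven, Finite.card_option]

/-- **`q + 1` neighbours at every type-two vertex, given the transitivity binder `htr₂`** (any ramified place; transport ★ `ncard_neighborSet_eq_ncard_neighborSet_N₁_of_htr₂`).
[cite: Tits1979, §2.4] [cite: BruhatTits1972, §10] -/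
theorem ncard_neighborSet_of_isVertexLattice_two_of_even (hσ : ∀ x, σ (σ x) = x) (hvσ : ∀ a, Valued.v (σ a) = Valued.v a) (hϖ : Valued.v ϖ = WithZero.exp (-1 : ℤ))
    (heven : ∀ x : K, σ x = x → x ≠ 0 → ∃ n : ℤ, Valued.v x = WithZero.exp (2 * n)) [Finite 𝓀[K]]
    (htr₂ : ∀ M : Submodule 𝒪[K] (Fin 3 → K), IsVertexLattice σ ϖ ((StdForm.antidiagonal 3).over K) 2 M → ∃ u : unitaryGroupOfForm σ ((StdForm.antidiagonal 3).over K), M = mapGL (u : GL (Fin 3) K) (latt (Matrix.diagonal ![(1 : K), 1, ϖ])))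
    (v : {M : Submodule 𝒪[K] (Fin 3 → K) // IsVertex σ ϖ ((StdForm.antidiagonal 3).over K) M}) (hv : IsVertexLattice σ ϖ ((StdForm.antidiagonal 3).over K) 2 v.1) :
    ((latticeGraph σ ϖ ((StdForm.antidiagonal 3).over K)).neighborSet v).ncard = Nat.card 𝓀[K] + 1 := by
  rw [ncard_neighborSet_eq_ncard_neighborSet_N₁_of_htr₂ (isVertexLattice_two_N₁_of_uniformizer hvσ hϖ) htr₂ v hv, ncard_neighborSet_N₁_of_even hσ hvσ hϖ heven]

/-- **EVERY TYPE-TWO VERTEX OF THE `U(3)` TREE HAS EXACTLY `q + 1` NEIGHBOURS AT ANY RAMIFIED PLACE, WILD ONES INCLUDED — `htr₂` discharged by ★ htr₂-wild**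
(`σ` an isometric involution, residually trivial, non-zero fixed elements of even valuation, `2 ≠ 0`, finite residue field). [cite: Tits1979, §2.4, §2.7] [cite: Jacobowitz1962, §§9–11] [cite: BruhatTits1972, §10] -/
theorem ncard_neighborSet_of_isVertexLattice_two_wild [Finite 𝓀[K]] (hσ : ∀ x, σ (σ x) = x) (hvσ : ∀ a, Valued.v (σ a) = Valued.v a) (hϖ : Valued.v ϖ = WithZero.exp (-1 : ℤ))
    (hres : ∀ x : K, Valued.v x ≤ 1 → Valued.v (σ x - x) < 1) (heven : ∀ x : K, σ x = x → x ≠ 0 → ∃ n : ℤ, Valued.v x = WithZero.exp (2 * n)) (h20 : (2 : K) ≠ 0)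
    (v : {M : Submodule 𝒪[K] (Fin 3 → K) // IsVertex σ ϖ ((StdForm.antidiagonal 3).over K) M}) (hv : IsVertexLattice σ ϖ ((StdForm.antidiagonal 3).over K) 2 v.1) :
    ((latticeGraph σ ϖ ((StdForm.antidiagonal 3).over K)).neighborSet v).ncard = Nat.card 𝓀[K] + 1 :=
  ncard_neighborSet_of_isVertexLattice_two_of_even hσ hvσ hϖ heven (forall_isVertexLattice_two_exists_mapGL_N₁_eq_of_ramified hσ hvσ hϖ hres heven h20) v hv

/-- **THE DATUM-FORM HEAD (the shape of U0's `stub_U0_valency_typeTwo_wild`)**: for every `IsRamifiedQuadraticDatum σ ϖ d t` with finite residue field and every type-two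
vertex `v`, `#star(v) = |𝓀[K]| + 1` — residual triviality from the datum by ★ `v_map_sub_self_lt_one_of_even`, `2 ≠ 0` from `|2| = |ϖ|^t`. [cite: Tits1979, §2.4, §2.7] [cite: BruhatTits1972, §10] -/
theorem ncard_neighborSet_of_isVertexLattice_two_of_isRamifiedQuadraticDatum {K : Type} [Field K] [Valued K ℤᵐ⁰] [Finite 𝓀[K]] (σ : K →+* K) (ϖ : K) (d t : ℕ)
    (hD : IsRamifiedQuadraticDatum σ ϖ d t) (v : {M : Submodule 𝒪[K] (Fin 3 → K) // IsVertex σ ϖ ((StdForm.antidiagonal 3).over K) M})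
    (hv : IsVertexLattice σ ϖ ((StdForm.antidiagonal 3).over K) 2 v.1) :
    ((latticeGraph σ ϖ ((StdForm.antidiagonal 3).over K)).neighborSet v).ncard = Nat.card 𝓀[K] + 1 := by
  obtain ⟨hσ, hvσ, hϖ, heven, hd, h1d, h2t⟩ := hD
  have h20 : (2 : K) ≠ 0 := fun h2 => by
    rw [h2, map_zero] at h2t
    exact pow_ne_zero _ ((Valuation.ne_zero_iff _).2 (uniformizer_ne_zero hϖ)) h2t.symm
  exact ncard_neighborSet_of_isVertexLattice_two_wild hσ hvσ hϖ (fun x hx => v_map_sub_self_lt_one_of_even hσ hϖ heven hd h1d hx) heven h20 v hv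

end Literature.NumberTheory.Automorphic.UnitaryLatticeTree

end
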